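/-
Copyright: statement-level skeleton of a published paper (lit-balaban cell, Phase-2 proof seat p31, gen 24). No proof claims beyond what the
kernel checks below.
-/
import Literature.MathematicalPhysics.QuantumFieldTheory.BalabanImbrieJaffe1984to88.BIJ88Eq249GaugeCovarianceTorus
import Literature.MathematicalPhysics.QuantumFieldTheory.BalabanImbrieJaffe1984to88.BIJ85Ineq723TorusDirichletStep

/-!
# `BalabanImbrieJaffe1984to88.BIJ88Eq249GaugeCovarianceStepTorus` — T. Bałaban, J. Imbrie, A. Jaffe, *Effective action and cluster properties of
the abelian Higgs model*, Commun. Math. Phys. **114** (1988) 257–315 [BalabanImbrieJaffe1988], §2 p. 265 [PDF 9], **(2.49) AND ITS "SIMILAR ESTIMATES"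
FOR THE SINGLE-STEP GAUGE-FIELD PROPAGATOR OF [I] = [BalabanImbrieJaffe1985] (4.3.3) p. 311 WITH DIRICHLET CONDITIONS OUTSIDE `Λ`, IN THE ONE-STEP
AXIAL GAUGE** — *"Lastly we note that the single-step covariance for the gauge field can be given a random walk expansion analogous to (2.45), with
similar estimates: C^{(k)}_Λ = C^{(k)}_{Λ,loc} + Σ_X C^{(k)}_{Λ,X}. (2.49)"* — for the propagator `C_{Wstep,Λ}` of the (4.3.1) action on the slice
`Wstep_Λ = Wstep ⊓ lamSub(Λ′₀)` of p27's `BIJ85Ineq723TorusDirichletStep` ([I] p. 311: *"C^{(k)} … the propagator … restricted to the subspace of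
B′s which satisfy the axial gauge condition"*, Dirichlet-localized as in [Balaban1984PropagatorsII] (2.154)), whose kernel p27 proved to be
`T̂·K_{W_Λ}·T̂ᵀ` (`kernel_stepLam_eq`, `T̂` = p09's bounded finite-range re-gauging matrix `regaugeMat` of [I] (5.1.1)) and whose middle factor p09
proved to be the [6II] (2.156) Λ-covariance `C^{(k)}_Λ = C_Λ(C_Λ*Δ_kC_Λ)⁻¹C_Λ*` read through the bond dictionary `idx` (`kernel_cornerLam_eq_cov`) —
the object given the walk expansion (2.49) in gen 24's `BIJ88Eq249GaugeCovarianceTorus` (p364896).  So (2.49), (2.42), the (2.41)/(7.2.3)-shape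
decay, (2.46) and (2.47) for `C_{Wstep,Λ}` are those theorems pushed through one more sandwich `K ↦ T̂KT̂ᵀ` (linear; entrywise convergent series
pass; a kernel bound `B` becomes `rowBound(d,L)²B`; a decay `(K₁, δ)` in the torus distance becomes `(K₁e^{2δL}rowBound², δ)` by pub-balaban's
`B6FromB4.sandwich_decay`; supports widen by the range `L` of `T̂`).  [I] p. 325 on (7.2.3): *"In fact this inequality also holds for propagators
with Dirichlet boundary conditions outside a domain Λ, uniformly in Λ"* — §4's `abs_stepLam_le_walk` is such a bound by the walk route, constants
from `(d, L)` only (p27's `ineq723_stepLam` is the Combes–Thomas route).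

statement-level skeleton of published theorems with citation tags; proofs where landed; nothing here is a claim about the Yang–Mills mass gap

PDF held: `paper:balaban1988-cmp114-bij-abelian-higgs-effective-action` (journal page = PDF page + 256; p. 265 = PDF 9 re-read this session);
`paper:balaban1985-cmp97-bij-higgs-minimizers` (journal page = PDF page + 298; p. 311 = PDF 13 and p. 325 = PDF 27 re-read this session,
`lit read … --pages 13` / `--pages 27-28`).

CITATION HEADER (lean-in-tree rule).  lit-balaban cell (HOME `run/shared/lean/pub/lit-balaban/`), Phase 2, proof seat **p31 gen 24** (unit `lit-balaban-p31`,
literature-prover-lit-balaban-p31-g24-0), free-target protocol G.5-34(d), TAKING #3 line HOME/STATUS.md (window 20 min; stem check `249Gauge|CovarianceStep`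
= {gen 24's `BIJ88Eq249GaugeCovarianceTorus`} only; cc r18, r15, p27, p09).  Rows served (CELLS, located members; heads unchanged): `HOME/lit-balaban-r18/ROWS-C2.md`
**C2.Eq2.49**, C2.Eq2.41 / 2.42 / 2.46 / 2.47 (gauge-field analogs, now also in the one-step axial gauge of [I]); `HOME/lit-balaban-r15` rows **C1.Eq4.3.3**,
C1.Eq4.3.5, **C1.Eq7.2.3** (Dirichlet-Λ propagators on `Wstep_Λ` / `W_Λ` by the walk route).  Files USED BY NAME, nothing restated: gen 24
`BIJ88Eq249GaugeCovarianceTorus` (`HalfBox`, `cA`, `sandw`, `walkK`, `eq249_torus`, `abs_covLam_le_torus`, `hasSum_walk_cov_DelK`, `ineq246_gX_DelK`,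
`close247_gauge_DelK`); p27 `BIJ85Ineq723TorusDirichletStep` (`WstepLam`, `KcornerLam`, `KcornerLam_apply`, `kernel_stepLam_eq`); p09 `BIJ85Ineq723Torus`
(`regaugeMat`, `rowBound`, `rowBound_pos`, `supDist_le_of_regaugeMat_ne_zero`, `regaugeMat_row_le`), `BIJ85Ineq723TorusDirichlet` (`WcornerLam`,
`kernel_cornerLam_eq_cov`), `BIJ85Ineq723TorusCornerGauge` (`idx`, `idx_fst_coe`, `L_dvd_Mk`), `BIJ85Eq431DeltaKBridge` (`one_le_Lpow`, `pdist_rep_eq_supDist`),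
`BIJ85AxialPropagator411` (`curlOp`, `V411`), `BIJ85UnitPropagator433` (`unitPropagator`), `BIJ85Prop521Torus` (`QsE`); r18 `BIJ88Sect2Statements` (`Eq245`,
`Ineq246`, `Close`); p13 `BIJ88RandomWalk242` / `BIJ88Eq242Lattice` / `BIJ88Ineq246Lattice` / `B4Sect5CubeBounds` (`cLoc`, `cX`, `memX`, `subset_closure`,
`ldist`, `cubeOf`, `touch`, `Cubes`, `labels`, `InBox`, `kR`, `thetaConst`, `thetaW`, `K0`); pub-balaban `B6FromB4.sandwich_decay`, `B6Cov2156TorusSubset`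
(`bondReductionLam`, `lamFree`, `elimLam`), `B6Cov2156TorusDelK` (`reDelK`, `gamma2153one`, `gamma2153one_pos`), `B5Eq117TorusCarriers.Mk`, `B6Lemma24Torus.pbox`,
`B6BondEliminationTorus.pdist`, `B3Bound323ZeroTorus.T_eq_supDist`, `B5Ineq137Torus.T_triangle`, `B3TorusRadialSums` (`supDist_eq_zero_iff`, `supDist_comm`).

## What is proved (0 `sorry`; axioms standard; theorems only)

* §1 the `T̂`-sandwich `K ↦ T̂KT̂ᵀ` on the bonds of `T₁^{(k)}`: `tsandw_apply` / `tsandw_add` / `tsandw_sub` / `tsandw_sum`, `hasSum_tsandw` (entrywise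
  unconditional series pass), `abs_tsandw_le_of_bound` (`|T̂KT̂ᵀ| ≤ rowBound²B`), **`abs_tsandw_le_of_decay`** (decay `(K₁, δ)` in `supDist` ⇒
  `(K₁e^{2δL}rowBound², δ)`), `exists_of_tsandw_ne_zero` (support bookkeeping); private `supDist_triangle_real`.
* §2 **`kernel_stepLam_eq_cov`**: `C_{Wstep,Λ}(b,b′) = (T̂·(C^{(k)}_Λ∘idx)·T̂ᵀ)(b,b′)` (p27 + p09 BY NAME).
* §3 the typed rows of r18's `BIJ88Sect2Statements` pass through the sandwich: **`eq245_tsandw`** ((2.45)/(2.49) shape), **`close_tsandw`** ((2.47)/`Close` in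
  `supDist`, constant `δe^{2cL}rowBound²`), **`ineq246_tsandw`** ((2.46): support widened by the range `L` of `T̂`, constant `c/2` once `rowBound² ≤ e^{(c/2)r}`;
  parts without cubes must carry no bond), and the readings through `idx`: `ineq246_idx`, `close_idx`.
* §4 FOR `C_{Wstep,Λ}` (all `∃ c₀ δ₀ > 0` from `d` — the kernel decay of `Δ_k` — then for every torus `Params` with the given `(d, L)`, every `k + 1 ≤ m + K`,
  every `Λ′₀` in half-torus position (`HalfBox`), cubes `M_c` above the explicit `(d, L)`-thresholds): **`eq249_stepLam`** ((2.49): `Eq245` INHABITED for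
  `C_{Wstep,Λ}` with `C_{loc} = T̂(C_ΛC_{loc}[A]C_Λᵀ∘idx)T̂ᵀ`, `C_X = T̂(C_ΛC_X[A]C_Λᵀ∘idx)T̂ᵀ`), **`hasSum_walk_stepLam`** ((2.42), unconditional),
  **`abs_stepLam_le_walk`** ((2.41)/(7.2.3)-shape decay in `supDist`, uniformly in `Λ`, `k` and the volume), **`ineq246_stepLam`** ((2.46) typed, `c = δ₀/(512·9^d)`,
  three explicit largeness conditions on `s = r(e_k)/M_c`), **`close247_stepLam`** ((2.47) typed `Close`).
* §5 the same for p09's corner-gauge Dirichlet propagator on `W_Λ` (kernel = `C^{(k)}_Λ∘idx` verbatim): **`eq249_cornerLam`**, **`abs_cornerLam_le_walk`**.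
HONEST SCOPE.  (i) Geometry as in gen 24's file: `Λ = B(Λ′₀)` in HALF-TORUS POSITION (`HalfBox`); a region wrapping around the torus and the whole torus are NOT
covered by these walk theorems (p27's `ineq723_stepLam` / p09's `ineq723_corner` cover every `Λ′₀` for the decay alone).  (ii) The one-step axial gauge is
[I] (4.3.3)'s `Wstep` intersected with the Dirichlet localization `lamSub Λ′₀` exactly as p27 defined it (`WstepLam`); *"argument in X"* of (2.46) is read
«within torus distance `L` of a bond coupled by `C_Λ` to a remaining variable of a block whose cube closure lies in `X`» (the two finite ranges `L` of `T̂`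
and `L − 1` of `C_Λ` are displayed, not hidden).  (iii) Constants: explicit products of gen 24's constants with `e^{2δL}rowBound(d,L)²`; no optimality
claimed; the (2.46)/(2.47) one-constant forms need `r(e_k)` large as displayed (p. 260: `r(e_k) → ∞`).  (iv) No background field `u` (pure gauge-field
covariance).  No `def`, no new named fact (D-0026).  Unit `lit-balaban-p31` (literature-prover-lit-balaban-p31-g24-0), 2026-08-23.  NOT summit progress.
-/

open scoped BigOperators Matrix
open Finset Matrix

namespace Literature.MathematicalPhysics.QuantumFieldTheory.BalabanImbrieJaffe1984to88.BIJ88Eq249GaugeCovarianceStepTorus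

open Literature.MathematicalPhysics.QuantumFieldTheory.Balaban1983to89
open LatticeFieldCalculus (supDist)
open BIJ85AxialPropagator411 (curlOp V411)
open BIJ85UnitPropagator433 (unitPropagator)
open BIJ85Prop521Torus (QsE)
open BIJ85Ineq723Torus (regaugeMat rowBound rowBound_pos supDist_le_of_regaugeMat_ne_zero regaugeMat_row_le)
open BIJ85Ineq723TorusCornerGauge (idx idx_fst_coe L_dvd_Mk)
open BIJ85Ineq723TorusDirichlet (WcornerLam kernel_cornerLam_eq_cov)
open BIJ85Ineq723TorusDirichletStep (WstepLam KcornerLam KcornerLam_apply kernel_stepLam_eq)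
open BIJ85Eq431DeltaKBridge (one_le_Lpow pdist_rep_eq_supDist)
open B5Eq117TorusCarriers (Mk)
open B6Lemma24Torus (pbox)
open B6Cov2156Torus (one_le_M)
open B6BondEliminationTorus (pdist)
open B6Cov2156TorusSubset (bondReductionLam lamFree elimLam)
open B6Cov2156TorusDelK (reDelK kernelDecay_reDelK reDelK_isSymm lowerOnConstrainedT_reDelK_sharp gamma2153one gamma2153one_pos)
open BIJ88RandomWalk242 BIJ88Eq242Lattice BIJ88Ineq246Lattice B4Sect5CubeBounds
open BIJ88Eq249GaugeCovarianceTorus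

noncomputable section

variable {P : Params} {k : ℕ}

/-- triangle inequality for `supDist` (through pub-balaban's torus distance `T`; p27's private copy re-derived). [folklore] -/
private theorem supDist_triangle_real (x y z : Balaban1983to89.Site P k) :
    (supDist x z : ℝ) ≤ (supDist x y : ℝ) + (supDist y z : ℝ) := by
  rw [← B3Bound323ZeroTorus.T_eq_supDist, ← B3Bound323ZeroTorus.T_eq_supDist, ← B3Bound323ZeroTorus.T_eq_supDist]
  exact B5Ineq137Torus.T_triangle P k x y z

/-! ## §1 The `T̂`-sandwich: linear algebra of `T̂ · K · T̂ᵀ` on the bonds of `T₁^{(k)}` -/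

section Sandwich

variable [DecidableEq (PBond P k)]

/-- kernel: entries of `T̂ K T̂ᵀ` as a double sum. [cite: BalabanImbrieJaffe1985, (5.1.1) p.313] -/
theorem tsandw_apply (K : Matrix (PBond P k) (PBond P k) ℝ) (b b' : PBond P k) :
    (regaugeMat P k * K * (regaugeMat P k)ᵀ) b b' = ∑ a', (∑ a, regaugeMat P k b a * K a a') * regaugeMat P k b' a' := by
  simp only [Matrix.mul_apply, Matrix.transpose_apply]

/-- kernel: `T̂ K T̂ᵀ` is additive in `K`. [cite: BalabanImbrieJaffe1985, (5.1.1) p.313] -/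
theorem tsandw_add (K K' : Matrix (PBond P k) (PBond P k) ℝ) :
    regaugeMat P k * (K + K') * (regaugeMat P k)ᵀ = regaugeMat P k * K * (regaugeMat P k)ᵀ + regaugeMat P k * K' * (regaugeMat P k)ᵀ := by
  rw [Matrix.mul_add, Matrix.add_mul]

/-- kernel: `T̂ K T̂ᵀ` is subtractive in `K`. [cite: BalabanImbrieJaffe1985, (5.1.1) p.313] -/
theorem tsandw_sub (K K' : Matrix (PBond P k) (PBond P k) ℝ) :
    regaugeMat P k * (K - K') * (regaugeMat P k)ᵀ = regaugeMat P k * K * (regaugeMat P k)ᵀ - regaugeMat P k * K' * (regaugeMat P k)ᵀ := by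
  rw [Matrix.mul_sub, Matrix.sub_mul]

/-- kernel: `T̂ K T̂ᵀ` commutes with finite sums in `K`. [cite: BalabanImbrieJaffe1985, (5.1.1) p.313] -/
theorem tsandw_sum {ξ : Type*} (s : Finset ξ) (K : ξ → Matrix (PBond P k) (PBond P k) ℝ) :
    regaugeMat P k * (∑ X ∈ s, K X) * (regaugeMat P k)ᵀ = ∑ X ∈ s, regaugeMat P k * K X * (regaugeMat P k)ᵀ := by
  rw [Matrix.mul_sum, Matrix.sum_mul]

/-- kernel: `T̂ K T̂ᵀ` of an unconditionally convergent series of kernels (entrywise `HasSum`) converges entrywise to the sandwich of the sum.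
[cite: BalabanImbrieJaffe1988, (2.42) p.264] -/
theorem hasSum_tsandw {ι' : Type*} {f : ι' → Matrix (PBond P k) (PBond P k) ℝ} {K : Matrix (PBond P k) (PBond P k) ℝ}
    (h : ∀ a a', HasSum (fun ω => f ω a a') (K a a')) (b b' : PBond P k) :
    HasSum (fun ω => (regaugeMat P k * f ω * (regaugeMat P k)ᵀ) b b') ((regaugeMat P k * K * (regaugeMat P k)ᵀ) b b') := by
  simp only [tsandw_apply]
  refine hasSum_sum fun a' _ => ?_
  exact (hasSum_sum fun a _ => (h a a').mul_left (regaugeMat P k b a)).mul_right (regaugeMat P k b' a')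

/-- kernel: `|T̂ K T̂ᵀ(b, b′)| ≤ rowBound²·B` when `|K| ≤ B` (row sums of `T̂` are `≤ rowBound(d, L)`, p09). [cite: BalabanImbrieJaffe1985, p.326 ("the gauge transformation λ in (5.1.1) is bounded")] -/
theorem abs_tsandw_le_of_bound (hk : k + 1 ≤ P.m + P.K) {K : Matrix (PBond P k) (PBond P k) ℝ} {B : ℝ} (hB : 0 ≤ B)
    (hK : ∀ a a', |K a a'| ≤ B) (b b' : PBond P k) :
    |(regaugeMat P k * K * (regaugeMat P k)ᵀ) b b'| ≤ rowBound P.d P.L * rowBound P.d P.L * B := by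
  rw [tsandw_apply]
  have hrow := fun b => regaugeMat_row_le hk b
  calc |∑ a', (∑ a, regaugeMat P k b a * K a a') * regaugeMat P k b' a'|
      ≤ ∑ a', |(∑ a, regaugeMat P k b a * K a a') * regaugeMat P k b' a'| := Finset.abs_sum_le_sum_abs _ _
    _ ≤ ∑ a', ((∑ a, |regaugeMat P k b a|) * B) * |regaugeMat P k b' a'| := by
        refine Finset.sum_le_sum fun a' _ => ?_
        rw [abs_mul]
        refine mul_le_mul_of_nonneg_right ?_ (abs_nonneg _)
        refine (Finset.abs_sum_le_sum_abs _ _).trans ?_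
        rw [Finset.sum_mul]
        refine Finset.sum_le_sum fun a _ => ?_
        rw [abs_mul]
        exact mul_le_mul_of_nonneg_left (hK a a') (abs_nonneg _)
    _ = (∑ a, |regaugeMat P k b a|) * B * ∑ a', |regaugeMat P k b' a'| := by rw [Finset.mul_sum]
    _ ≤ rowBound P.d P.L * B * rowBound P.d P.L := by
        have h3 : 0 ≤ ∑ a', |regaugeMat P k b' a'| := Finset.sum_nonneg fun _ _ => abs_nonneg _
        calc (∑ a, |regaugeMat P k b a|) * B * ∑ a', |regaugeMat P k b' a'|
            ≤ rowBound P.d P.L * B * ∑ a', |regaugeMat P k b' a'| := mul_le_mul_of_nonneg_right (mul_le_mul_of_nonneg_right (hrow b) hB) h3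
          _ ≤ rowBound P.d P.L * B * rowBound P.d P.L := mul_le_mul_of_nonneg_left (hrow b') (mul_nonneg (rowBound_pos _ _).le hB)
    _ = rowBound P.d P.L * rowBound P.d P.L * B := by ring

/-- kernel: a kernel with decay `(K₁, δ)` in the torus distance `supDist` has a `T̂`-sandwich with decay `(K₁e^{2δL}rowBound², δ)` in `supDist` (the range of
`T̂` is `≤ L`, its row sums `≤ rowBound`, p09; pv09's `sandwich_decay`). [cite: BalabanImbrieJaffe1985, (7.2.3) p.325] -/
theorem abs_tsandw_le_of_decay (hk : k + 1 ≤ P.m + P.K) {K : Matrix (PBond P k) (PBond P k) ℝ} {K₁ δ : ℝ} (hK₁ : 0 ≤ K₁) (hδ : 0 ≤ δ)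
    (hK : ∀ a a', |K a a'| ≤ K₁ * Real.exp (-(δ * (supDist a.src a'.src : ℝ)))) (b b' : PBond P k) :
    |(regaugeMat P k * K * (regaugeMat P k)ᵀ) b b'| ≤
      K₁ * Real.exp (2 * δ * P.L) * rowBound P.d P.L * rowBound P.d P.L * Real.exp (-(δ * (supDist b.src b'.src : ℝ))) := by
  -- the bonds with the `ℓ^∞` torus distance of their sources as a pseudo-metric space (inside this proof only; p27's private `bondPMS`)
  letI : PseudoMetricSpace (PBond P k) :=
    { dist := fun b b' => (supDist b.src b'.src : ℝ)
      dist_self := fun b => by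
        show (supDist b.src b.src : ℝ) = 0
        rw [(B3TorusRadialSums.supDist_eq_zero_iff _ _).2 rfl, Nat.cast_zero]
      dist_comm := fun b b' => by
        show (supDist b.src b'.src : ℝ) = (supDist b'.src b.src : ℝ)
        rw [B3TorusRadialSums.supDist_comm]
      dist_triangle := fun b b' b'' => supDist_triangle_real _ _ _ }
  have hrange : ∀ b a, regaugeMat P k b a ≠ 0 → dist b a ≤ (P.L : ℝ) := fun b a h => by
    show (supDist b.src a.src : ℝ) ≤ P.L
    exact_mod_cast supDist_le_of_regaugeMat_ne_zero hk h
  exact B6FromB4.sandwich_decay id id (regaugeMat P k) K (regaugeMat P k)ᵀ hK₁ hδ hrange (regaugeMat_row_le hk)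
    (fun v c h => by
      rw [Matrix.transpose_apply] at h
      rw [dist_comm]; exact hrange c v h)
    (fun c => by
      simp only [Matrix.transpose_apply]
      exact regaugeMat_row_le hk c)
    hK b b'

/-- kernel: a non-vanishing sandwich entry has a non-vanishing middle entry between bonds within torus distance `L` of `b`, `b′`. [cite: BalabanImbrieJaffe1985, p.326] -/
theorem exists_of_tsandw_ne_zero (hk : k + 1 ≤ P.m + P.K) {K : Matrix (PBond P k) (PBond P k) ℝ} {b b' : PBond P k}
    (h : (regaugeMat P k * K * (regaugeMat P k)ᵀ) b b' ≠ 0) :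
    ∃ a a', supDist b.src a.src ≤ P.L ∧ supDist b'.src a'.src ≤ P.L ∧ K a a' ≠ 0 := by
  rw [tsandw_apply] at h
  by_contra hne
  push Not at hne
  apply h
  refine Finset.sum_eq_zero fun a' _ => ?_
  by_cases hb' : regaugeMat P k b' a' = 0
  · rw [hb', mul_zero]
  · rw [Finset.sum_eq_zero fun a _ => ?_, zero_mul]
    by_cases hb : regaugeMat P k b a = 0
    · rw [hb, zero_mul]
    · rw [hne a a' (supDist_le_of_regaugeMat_ne_zero hk hb) (supDist_le_of_regaugeMat_ne_zero hk hb'), mul_zero]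

end Sandwich

/-! ## §2 The (4.3.3) Dirichlet propagator on `Wstep_Λ` through the corner-gauge Λ-covariance of gen 24 -/

variable [DecidableEq (PBond P k)]

/-- kernel (p09 + p27 BY NAME): **`C_{Wstep,Λ}(b, b′) = (T̂ · C^{(k)}_Λ∘idx · T̂ᵀ)(b, b′)`** — p27's `kernel_stepLam_eq` (`T̂ K_{W_Λ} T̂ᵀ`) with p09's
`kernel_cornerLam_eq_cov` (`K_{W_Λ}(a,a′) = (bondReductionLam … (Re Δ_k)).cov (idx a) (idx a′)`). [cite: BalabanImbrieJaffe1985, (4.3.3) p.311; Balaban1984PropagatorsII, (2.156) p.250] -/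
theorem kernel_stepLam_eq_cov (hd : 2 ≤ P.d) (hk : k + 1 ≤ P.m + P.K) (Λ'₀ : Finset (Fin P.d → ℤ)) (b b' : PBond P k) :
    unitPropagator (V411 P k) (curlOp (P := P) (P.eta k ^ P.d) ((P.L : ℝ) ^ k)) (QsE P k) (WstepLam P k Λ'₀) (EuclideanSpace.single b' 1) b =
      (regaugeMat P k * Matrix.of (fun a a' : PBond P k =>
          (bondReductionLam P.L (Mk P k) Λ'₀ (reDelK (P.L ^ k) (one_le_Lpow P k) (Mk P k))).cov (idx P k a) (idx P k a')) *
        (regaugeMat P k)ᵀ) b b' := by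
  have hK : KcornerLam P k Λ'₀ = Matrix.of (fun a a' : PBond P k =>
      (bondReductionLam P.L (Mk P k) Λ'₀ (reDelK (P.L ^ k) (one_le_Lpow P k) (Mk P k))).cov (idx P k a) (idx P k a')) := by
    ext a a'
    rw [KcornerLam_apply, Matrix.of_apply, kernel_cornerLam_eq_cov hd hk]
  rw [kernel_stepLam_eq hd hk, hK]


/-! ## §3 The typed rows of [BIJ88] §2 pass through the `T̂`-sandwich (kernels on the box variables, read on the bonds through p09's `idx`) -/

/-- kernel: an identity of (2.45)/(2.49) shape `C = C_loc + Σ_X C_X` between kernels read on the bonds gives the same identity between their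
`T̂`-sandwiches. [cite: BalabanImbrieJaffe1988, (2.45) p.264, (2.49) p.265] -/
theorem eq245_tsandw {ξ : Type*} [Fintype ξ] {C Cloc : PBond P k → PBond P k → ℝ} {CX : ξ → PBond P k → PBond P k → ℝ}
    (h : BIJ88Sect2Statements.Eq245 C Cloc CX) :
    BIJ88Sect2Statements.Eq245 (fun b b' : PBond P k => (regaugeMat P k * Matrix.of C * (regaugeMat P k)ᵀ) b b')
      (fun b b' => (regaugeMat P k * Matrix.of Cloc * (regaugeMat P k)ᵀ) b b')
      (fun X b b' => (regaugeMat P k * Matrix.of (CX X) * (regaugeMat P k)ᵀ) b b') := by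
  intro b b'
  have hC : Matrix.of C = Matrix.of Cloc + ∑ X, Matrix.of (CX X) := by
    ext a a'
    rw [Matrix.of_apply, Matrix.add_apply, Matrix.sum_apply, Matrix.of_apply]
    simp only [Matrix.of_apply]
    exact h a a'
  dsimp only
  rw [hC, tsandw_add, tsandw_sum, Matrix.add_apply, Matrix.sum_apply]

/-- kernel: a (2.47)-shape closeness `|K_loc − K| ≤ δe^{−c|b₋−b′₋|}` between kernels read on the bonds (torus distance of `T₁^{(k)}`) gives
`|T̂K_locT̂ᵀ − T̂KT̂ᵀ| ≤ δe^{2cL}rowBound²·e^{−c|b₋−b′₋|}`. [cite: BalabanImbrieJaffe1988, (2.47) p.265; BalabanImbrieJaffe1985, (7.2.3) p.325] -/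
theorem close_tsandw (hk : k + 1 ≤ P.m + P.K) {Kloc K : PBond P k → PBond P k → ℝ} {δ c : ℝ} (hδ : 0 ≤ δ) (hc : 0 ≤ c)
    (h : BIJ88Sect2Statements.Close (fun b b' : PBond P k => (supDist b.src b'.src : ℝ)) Kloc K δ c) :
    BIJ88Sect2Statements.Close (fun b b' : PBond P k => (supDist b.src b'.src : ℝ))
      (fun b b' => (regaugeMat P k * Matrix.of Kloc * (regaugeMat P k)ᵀ) b b')
      (fun b b' => (regaugeMat P k * Matrix.of K * (regaugeMat P k)ᵀ) b b')
      (δ * Real.exp (2 * c * P.L) * rowBound P.d P.L * rowBound P.d P.L) c := by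
  intro b b'
  dsimp only
  rw [← Matrix.sub_apply, ← tsandw_sub, neg_mul]
  refine abs_tsandw_le_of_decay hk hδ hc (fun a a' => ?_) b b'
  have h1 := h a a'
  dsimp only at h1
  rw [neg_mul] at h1
  rw [Matrix.sub_apply, Matrix.of_apply, Matrix.of_apply]
  exact h1

/-- kernel: a (2.46)-shape row (support in `X` + the one-constant bound `e^{−c·r·|X|}`) for `X`-parts read on the bonds gives the (2.46)-shape row
for their `T̂`-sandwiches, with *"argument in X"* widened by the range `L` of `T̂` (p09: «within torus distance `L` of a bond in `X`») and the
constant `c/2`, once `rowBound² ≤ e^{(c/2)r}` (the prefactor absorbed by `r(e_k) → ∞`, p. 260); parts with no cube (`|X| = 0`) must carry no bond.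
[cite: BalabanImbrieJaffe1988, (2.46) p.264, (2.49) p.265] -/
theorem ineq246_tsandw (hk : k + 1 ≤ P.m + P.K) {ξ : Type*} {ncubes : ξ → ℕ} {mem : PBond P k → ξ → Prop}
    {CX : ξ → PBond P k → PBond P k → ℝ} {c rek : ℝ} (hc : 0 ≤ c) (hrek : 0 ≤ rek)
    (h : BIJ88Sect2Statements.Ineq246 ncubes mem CX c rek) (hempty : ∀ X, ncubes X = 0 → ∀ x, ¬ mem x X)
    (hlarge : rowBound P.d P.L * rowBound P.d P.L ≤ Real.exp (c / 2 * rek)) :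
    BIJ88Sect2Statements.Ineq246 ncubes (fun (b : PBond P k) X => ∃ a : PBond P k, supDist b.src a.src ≤ P.L ∧ mem a X)
      (fun X b b' => (regaugeMat P k * Matrix.of (CX X) * (regaugeMat P k)ᵀ) b b') (c / 2) rek := by
  have hsupp : ∀ X (b b' : PBond P k), (regaugeMat P k * Matrix.of (CX X) * (regaugeMat P k)ᵀ) b b' ≠ 0 →
      (∃ a : PBond P k, supDist b.src a.src ≤ P.L ∧ mem a X) ∧ ∃ a : PBond P k, supDist b'.src a.src ≤ P.L ∧ mem a X := by
    intro X b b' hne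
    obtain ⟨a, a', ha, ha', hK⟩ := exists_of_tsandw_ne_zero hk hne
    rw [Matrix.of_apply] at hK
    have hm : mem a X ∧ mem a' X := by
      by_contra hnot
      exact hK (h.1 X _ _ hnot)
    exact ⟨⟨a, ha, hm.1⟩, ⟨a', ha', hm.2⟩⟩
  refine ⟨fun X b b' hnot => ?_, fun X b b' => ?_⟩
  · by_contra hne
    exact hnot (hsupp X b b' hne)
  · dsimp only
    rcases Nat.eq_zero_or_pos (ncubes X) with h0 | hpos
    · have hz : (regaugeMat P k * Matrix.of (CX X) * (regaugeMat P k)ᵀ) b b' = 0 := by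
        by_contra hne
        obtain ⟨⟨a, -, hm⟩, -⟩ := hsupp X b b' hne
        exact hempty X h0 _ hm
      rw [hz, abs_zero]
      positivity
    · have hB : 0 ≤ Real.exp (-c * rek * ncubes X) := by positivity
      refine (abs_tsandw_le_of_bound hk hB (fun a a' => ?_) b b').trans ?_
      · rw [Matrix.of_apply]; exact h.2 X _ _
      · have h1 : (1 : ℝ) ≤ ncubes X := by exact_mod_cast hpos
        calc rowBound P.d P.L * rowBound P.d P.L * Real.exp (-c * rek * ncubes X)
            ≤ Real.exp (c / 2 * rek) * Real.exp (-c * rek * ncubes X) := mul_le_mul_of_nonneg_right hlarge hB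
          _ = Real.exp (c / 2 * rek - c * rek * ncubes X) := by rw [← Real.exp_add]; ring_nf
          _ ≤ Real.exp (-(c / 2) * rek * ncubes X) := Real.exp_le_exp.2 (by
                have h2 : c / 2 * rek ≤ c / 2 * rek * ncubes X := by
                  have h3 : 0 ≤ c / 2 * rek := by positivity
                  nlinarith
                nlinarith)

omit [DecidableEq (PBond P k)] in
/-- kernel: the typed rows read through p09's dictionary `idx` (a bijection `PBond P k ≃` box variables): (2.46). [cite: BalabanImbrieJaffe1988, (2.46) p.264] -/
theorem ineq246_idx {ξ : Type*} {ncubes : ξ → ℕ} {mem : B4.Idx (pbox (Mk P k)) P.d → ξ → Prop}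
    {CX : ξ → B4.Idx (pbox (Mk P k)) P.d → B4.Idx (pbox (Mk P k)) P.d → ℝ} {c rek : ℝ} (h : BIJ88Sect2Statements.Ineq246 ncubes mem CX c rek) :
    BIJ88Sect2Statements.Ineq246 ncubes (fun (b : PBond P k) X => mem (idx P k b) X) (fun X b b' => CX X (idx P k b) (idx P k b')) c rek :=
  ⟨fun X _ _ hnot => h.1 X _ _ hnot, fun X _ _ => h.2 X _ _⟩

omit [DecidableEq (PBond P k)] in
/-- kernel: the typed rows read through `idx`: (2.47)/`Close`, the box-coordinate torus distance of base points becoming `supDist` of sources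
(p09's `pdist_rep_eq_supDist`). [cite: BalabanImbrieJaffe1988, (2.47) p.265] -/
theorem close_idx {Kloc K : B4.Idx (pbox (Mk P k)) P.d → B4.Idx (pbox (Mk P k)) P.d → ℝ} {δ c : ℝ}
    (h : BIJ88Sect2Statements.Close
      (fun x x' : B4.Idx (pbox (Mk P k)) P.d => pdist (Mk P k) (one_le_M (Mk P k)) (x.1 : Fin P.d → ℤ) (x'.1 : Fin P.d → ℤ)) Kloc K δ c) :
    BIJ88Sect2Statements.Close (fun b b' : PBond P k => (supDist b.src b'.src : ℝ)) (fun b b' => Kloc (idx P k b) (idx P k b'))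
      (fun b b' => K (idx P k b) (idx P k b')) δ c := by
  intro b b'
  have h1 := h (idx P k b) (idx P k b')
  dsimp only at h1 ⊢
  rw [idx_fst_coe, idx_fst_coe, pdist_rep_eq_supDist] at h1
  exact h1

/-! ## §4 (2.49) AND ITS "SIMILAR ESTIMATES" FOR THE (4.3.3) DIRICHLET PROPAGATOR ON `Wstep_Λ` (the one-step axial gauge of [I], centred blocks) -/

/-- **(2.49) FOR THE SINGLE-STEP GAUGE-FIELD PROPAGATOR OF [I] WITH DIRICHLET CONDITIONS OUTSIDE `Λ`, IN THE ONE-STEP AXIAL GAUGE (4.3.3)**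
(`C_{Wstep,Λ} = T̂·C^{(k)}_Λ·T̂ᵀ`, p27; `C^{(k)}_Λ` of [6II] (2.156) for the genuine `Δ_k`): for `d ≥ 2`, `L ≥ 1` there are `c₀, δ₀ > 0` such that for
every torus `Setup` with these `(d, L)`, every `k + 1 ≤ m + K`, every `Λ′₀` in half-torus position, cubes `M_c ≥ 5`, `M_c > K_R(d,L)`, `M_c > Θ₁(d,L)`,
every `ρ`, `s`: `BIJ88Sect2Statements.Eq245` holds for `C_{Wstep,Λ}(b,b′)` with `C_{loc} = T̂·(C_ΛC_{loc}[A]C_Λᵀ)·T̂ᵀ`, `C_X = T̂·(C_ΛC_X[A]C_Λᵀ)·T̂ᵀ`.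
[cite: BalabanImbrieJaffe1988, (2.49) p.265; BalabanImbrieJaffe1985, (4.3.3) p.311; Balaban1984PropagatorsII, (2.156) p.250] -/
theorem eq249_stepLam (d L : ℕ) (hd2 : 2 ≤ d) (hL : 1 ≤ L) :
    ∃ c₀ δ₀ : ℝ, 0 < c₀ ∧ 0 < δ₀ ∧ ∀ (P : Params), P.d = d → P.L = L → ∀ (k : ℕ) [DecidableEq (PBond P k)] (hk : k + 1 ≤ P.m + P.K)
      (Λ'₀ : Finset (Fin P.d → ℤ)), HalfBox P.L (Mk P k) Λ'₀ → ∀ (Mc : ℕ), 5 ≤ Mc →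
      kR P.d P.d (gamma2153one P.d P.L) (cA P.d P.L (gamma2153one P.d P.L) c₀ δ₀) δ₀ < Mc →
      thetaConst P.d P.d (gamma2153one P.d P.L) (cA P.d P.L (gamma2153one P.d P.L) c₀ δ₀) δ₀ < Mc → ∀ (ρ : ℝ) (s : ℕ),
      BIJ88Sect2Statements.Eq245
        (fun b b' : PBond P k =>
          unitPropagator (V411 P k) (curlOp (P := P) (P.eta k ^ P.d) ((P.L : ℝ) ^ k)) (QsE P k) (WstepLam P k Λ'₀) (EuclideanSpace.single b' 1) b)
        (fun b b' => (regaugeMat P k * Matrix.of (fun a a' : PBond P k => sandw P.L (Mk P k) Λ'₀ (cLoc (ldist (N := P.d) Mc) ρ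
            (walkK P.L (Mk P k) Λ'₀ (reDelK (P.L ^ k) (one_le_Lpow P k) (Mk P k)) (gamma2153one P.d P.L) Mc)) (idx P k a) (idx P k a')) *
          (regaugeMat P k)ᵀ) b b')
        (fun (X : Finset (Cubes Mc s (pbox (Mk P k)))) b b' => (regaugeMat P k * Matrix.of (fun a a' : PBond P k =>
            sandw P.L (Mk P k) Λ'₀ (cX (ldist (N := P.d) Mc) ρ (cubeOf Mc s) touch
              (walkK P.L (Mk P k) Λ'₀ (reDelK (P.L ^ k) (one_le_Lpow P k) (Mk P k)) (gamma2153one P.d P.L) Mc) X) (idx P k a) (idx P k a')) *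
          (regaugeMat P k)ᵀ) b b') := by
  obtain ⟨c₀, δ₀, hc, hδ, H⟩ := eq249_torus d L hd2 hL
  refine ⟨c₀, δ₀, hc, hδ, fun P hPd hPL k _ hk Λ'₀ hbox Mc hM5 hMR hMθ ρ s => ?_⟩
  have h := H P hPd hPL k hk Λ'₀ hbox Mc hM5 hMR hMθ ρ s
  subst hPd hPL
  intro b b'
  have h2 := eq245_tsandw h b b'
  dsimp only at h2 ⊢
  rw [kernel_stepLam_eq_cov hd2 hk]
  exact h2

/-- **(2.42) FOR `C_{Wstep,Λ}`**: under the same data, `C_{Wstep,Λ}(b,b′) = Σ_ω (T̂·C_ΛC_ωC_Λᵀ·T̂ᵀ)(b,b′)` unconditionally (file 1's `hasSum_walk_cov_DelK`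
through the sandwich). [cite: BalabanImbrieJaffe1988, (2.42) p.264, (2.49) p.265; BalabanImbrieJaffe1985, (4.3.3) p.311] -/
theorem hasSum_walk_stepLam (d L : ℕ) (hd2 : 2 ≤ d) (hL : 1 ≤ L) :
    ∃ c₀ δ₀ : ℝ, 0 < c₀ ∧ 0 < δ₀ ∧ ∀ (P : Params), P.d = d → P.L = L → ∀ (k : ℕ) [DecidableEq (PBond P k)] (hk : k + 1 ≤ P.m + P.K)
      (Λ'₀ : Finset (Fin P.d → ℤ)), HalfBox P.L (Mk P k) Λ'₀ → ∀ (Mc : ℕ), 5 ≤ Mc →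
      kR P.d P.d (gamma2153one P.d P.L) (cA P.d P.L (gamma2153one P.d P.L) c₀ δ₀) δ₀ < Mc →
      thetaConst P.d P.d (gamma2153one P.d P.L) (cA P.d P.L (gamma2153one P.d P.L) c₀ δ₀) δ₀ < Mc → ∀ b b' : PBond P k,
      HasSum (fun ω => (regaugeMat P k * Matrix.of (fun a a' : PBond P k => sandw P.L (Mk P k) Λ'₀
            (walkK P.L (Mk P k) Λ'₀ (reDelK (P.L ^ k) (one_le_Lpow P k) (Mk P k)) (gamma2153one P.d P.L) Mc ω) (idx P k a) (idx P k a')) *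
          (regaugeMat P k)ᵀ) b b')
        (unitPropagator (V411 P k) (curlOp (P := P) (P.eta k ^ P.d) ((P.L : ℝ) ^ k)) (QsE P k) (WstepLam P k Λ'₀) (EuclideanSpace.single b' 1) b) := by
  obtain ⟨c₀, δ₀, hc, hδ, H⟩ := hasSum_walk_cov_DelK (d := d) (L := L) hd2 hL
  refine ⟨c₀, δ₀, hc, hδ, fun P hPd hPL k _ hk Λ'₀ hbox Mc hM5 hMR hMθ b b' => ?_⟩
  subst hPd hPL
  rw [kernel_stepLam_eq_cov hd2 hk]
  exact hasSum_tsandw (fun a a' => by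
    rw [Matrix.of_apply]
    exact H (Mk P k) (L_dvd_Mk hk) (P.L ^ k) (one_le_Lpow P k) Λ'₀ hbox Mc hM5 hMR hMθ (idx P k a) (idx P k a')) b b'

/-- **(2.41)/(7.2.3)-SHAPE DECAY OF `C_{Wstep,Λ}` BY THE WALK ROUTE, UNIFORMLY IN `Λ`, `k` AND THE VOLUME**: for `d ≥ 2`, `L ≥ 1` there are `c₀, δ₀ > 0`
with `|C_{Wstep,Λ}(b,b′)| ≤ K₁e^{2δ′(L−1)}(L^d+1)²·e^{2δ′L}rowBound(d,L)²·e^{−δ′|b₋−b′₋|}`, `δ′ = δ₀/(8M_c)`, `K₁ = 2^dγ′^{−1}(1−θ_W)^{−1}e^{δ₀/4}`, for every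
torus `Setup` with these `(d, L)`, `k + 1 ≤ m + K`, `Λ′₀` in half-torus position and cubes above the `(d, L)`-thresholds with `θ_W < 1` (cf. p27's
`ineq723_stepLam` by the Combes–Thomas route). [cite: BalabanImbrieJaffe1988, (2.41) p.264, (2.49) p.265; BalabanImbrieJaffe1985, (7.2.3) p.325] -/
theorem abs_stepLam_le_walk (d L : ℕ) (hd2 : 2 ≤ d) (hL : 1 ≤ L) :
    ∃ c₀ δ₀ : ℝ, 0 < c₀ ∧ 0 < δ₀ ∧ ∀ (P : Params), P.d = d → P.L = L → ∀ (k : ℕ) [DecidableEq (PBond P k)] (hk : k + 1 ≤ P.m + P.K)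
      (Λ'₀ : Finset (Fin P.d → ℤ)), HalfBox P.L (Mk P k) Λ'₀ → ∀ (Mc : ℕ), 5 ≤ Mc →
      kR P.d P.d (gamma2153one P.d P.L) (cA P.d P.L (gamma2153one P.d P.L) c₀ δ₀) δ₀ < Mc →
      thetaConst P.d P.d (gamma2153one P.d P.L) (cA P.d P.L (gamma2153one P.d P.L) c₀ δ₀) δ₀ < Mc →
      thetaW P.d P.d (gamma2153one P.d P.L) (cA P.d P.L (gamma2153one P.d P.L) c₀ δ₀) δ₀ Mc < 1 → ∀ b b' : PBond P k,
      |unitPropagator (V411 P k) (curlOp (P := P) (P.eta k ^ P.d) ((P.L : ℝ) ^ k)) (QsE P k) (WstepLam P k Λ'₀) (EuclideanSpace.single b' 1) b| ≤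
        (2 ^ P.d * (gamma2153one P.d P.L)⁻¹ *
              (1 - thetaW P.d P.d (gamma2153one P.d P.L) (cA P.d P.L (gamma2153one P.d P.L) c₀ δ₀) δ₀ Mc)⁻¹ * Real.exp (δ₀ / 4)) *
          Real.exp (2 * (δ₀ / 8 / Mc) * ((P.L : ℝ) - 1)) * ((P.L : ℝ) ^ P.d + 1) * ((P.L : ℝ) ^ P.d + 1) *
          Real.exp (2 * (δ₀ / 8 / Mc) * P.L) * rowBound P.d P.L * rowBound P.d P.L *
          Real.exp (-(δ₀ / 8 / Mc * (supDist b.src b'.src : ℝ))) := by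
  obtain ⟨c₀, δ₀, hc, hδ, H⟩ := abs_covLam_le_torus d L hd2 hL
  refine ⟨c₀, δ₀, hc, hδ, fun P hPd hPL k _ hk Λ'₀ hbox Mc hM5 hMR hMθ hθW b b' => ?_⟩
  have hK := H P hPd hPL k hk Λ'₀ hbox Mc hM5 hMR hMθ hθW
  subst hPd hPL
  rw [kernel_stepLam_eq_cov hd2 hk]
  have hγ := gamma2153one_pos (d := P.d) (L := P.L) (by omega) hL
  have hK₁ : 0 ≤ (2 ^ P.d * (gamma2153one P.d P.L)⁻¹ *
        (1 - thetaW P.d P.d (gamma2153one P.d P.L) (cA P.d P.L (gamma2153one P.d P.L) c₀ δ₀) δ₀ Mc)⁻¹ * Real.exp (δ₀ / 4)) *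
      Real.exp (2 * (δ₀ / 8 / Mc) * ((P.L : ℝ) - 1)) * ((P.L : ℝ) ^ P.d + 1) * ((P.L : ℝ) ^ P.d + 1) := by
    have : 0 < 1 - thetaW P.d P.d (gamma2153one P.d P.L) (cA P.d P.L (gamma2153one P.d P.L) c₀ δ₀) δ₀ Mc := by linarith
    positivity
  exact abs_tsandw_le_of_decay hk hK₁ (by positivity) (fun a a' => by rw [Matrix.of_apply]; exact hK a a') b b'

/-- **(2.46) TYPED FOR `C_{Wstep,Λ}`**: for `d ≥ 2`, `L ≥ 1` there are `c₀, δ₀ > 0` such that for every torus `Setup` with these `(d, L)`, `k + 1 ≤ m + K`,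
`Λ′₀` in half-torus position, cubes above the `(d, L)`-thresholds with `θ_W < 1`, and `r(e_k)`-cubes of `s > 0` labels large enough
(`K₀ ≤ e^{(δ₀/(128·9^d))s}`, `(L^d+1)² ≤ e^{(δ₀/(256·9^d))s}`, `rowBound² ≤ e^{(δ₀/(512·9^d))s}`), `BIJ88Sect2Statements.Ineq246` holds for the `X`-parts
`T̂·(C_ΛC_X[A]C_Λᵀ)·T̂ᵀ` of `C_{Wstep,Λ}` with `c = δ₀/(512·9^d)`; *"argument in X"* read «within torus distance `L` of a bond coupled by `C_Λ` to a
remaining variable of a block whose cube closure lies in `X`». [cite: BalabanImbrieJaffe1988, (2.46) p.264, (2.49) p.265; BalabanImbrieJaffe1985, (4.3.3) p.311] -/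
theorem ineq246_stepLam (d L : ℕ) (hd2 : 2 ≤ d) (hL : 1 ≤ L) :
    ∃ c₀ δ₀ : ℝ, 0 < c₀ ∧ 0 < δ₀ ∧ ∀ (P : Params), P.d = d → P.L = L → ∀ (k : ℕ) [DecidableEq (PBond P k)] (hk : k + 1 ≤ P.m + P.K)
      (Λ'₀ : Finset (Fin P.d → ℤ)), HalfBox P.L (Mk P k) Λ'₀ → ∀ (Mc : ℕ), 5 ≤ Mc →
      kR P.d P.d (gamma2153one P.d P.L) (cA P.d P.L (gamma2153one P.d P.L) c₀ δ₀) δ₀ < Mc →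
      thetaConst P.d P.d (gamma2153one P.d P.L) (cA P.d P.L (gamma2153one P.d P.L) c₀ δ₀) δ₀ < Mc →
      thetaW P.d P.d (gamma2153one P.d P.L) (cA P.d P.L (gamma2153one P.d P.L) c₀ δ₀) δ₀ Mc < 1 → ∀ (s : ℕ), 0 < s →
      K0 P.d P.d (gamma2153one P.d P.L) (cA P.d P.L (gamma2153one P.d P.L) c₀ δ₀) δ₀ Mc ≤ Real.exp (δ₀ / (128 * 9 ^ P.d) * s) →
      ((P.L : ℝ) ^ P.d + 1) * ((P.L : ℝ) ^ P.d + 1) ≤ Real.exp (δ₀ / (256 * 9 ^ P.d) * s) →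
      rowBound P.d P.L * rowBound P.d P.L ≤ Real.exp (δ₀ / (256 * 9 ^ P.d) / 2 * s) →
      BIJ88Sect2Statements.Ineq246 (fun X : Finset (Cubes Mc s (pbox (Mk P k))) => X.card)
        (fun (b : PBond P k) (X : Finset (Cubes Mc s (pbox (Mk P k)))) => ∃ a : PBond P k, supDist b.src a.src ≤ P.L ∧
          ∃ q : ↥(lamFree P.L (Mk P k) Λ'₀), elimLam P.L (Mk P k) Λ'₀ (idx P k a) q ≠ 0 ∧
            memX (fun (x : B4.Idx (pbox (Mk P k)) P.d) (l : ↥(labels Mc (pbox (Mk P k)))) => InBox Mc l.1 (x.1 : Fin P.d → ℤ)) (cubeOf Mc s) touch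
              (q : B4.Idx (pbox (Mk P k)) P.d) X)
        (fun X b b' => (regaugeMat P k * Matrix.of (fun a a' : PBond P k =>
            sandw P.L (Mk P k) Λ'₀ (cX (ldist (N := P.d) Mc) ((s : ℝ) / 4) (cubeOf Mc s) touch
              (walkK P.L (Mk P k) Λ'₀ (reDelK (P.L ^ k) (one_le_Lpow P k) (Mk P k)) (gamma2153one P.d P.L) Mc) X) (idx P k a) (idx P k a')) *
          (regaugeMat P k)ᵀ) b b')
        (δ₀ / (256 * 9 ^ P.d) / 2) s := by
  obtain ⟨c₀, δ₀, hc, hδ, H⟩ := ineq246_gX_DelK (d := d) (L := L) hd2 hL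
  refine ⟨c₀, δ₀, hc, hδ, fun P hPd hPL k _ hk Λ'₀ hbox Mc hM5 hMR hMθ hθW s hs0 hlarge hlargeL hlargeR => ?_⟩
  subst hPd hPL
  have h := ineq246_idx (P := P) (k := k)
    (H (Mk P k) (L_dvd_Mk hk) (P.L ^ k) (one_le_Lpow P k) Λ'₀ hbox Mc hM5 hMR hMθ hθW s hs0 hlarge hlargeL)
  refine ineq246_tsandw hk (by positivity) (Nat.cast_nonneg s) h (fun X hX x hm => ?_) hlargeR
  obtain ⟨q, -, j, -, hj⟩ := hm
  have hmem := hj (subset_closure touch {cubeOf Mc s j} (Finset.mem_singleton_self _))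
  rw [Finset.card_eq_zero.mp hX] at hmem
  exact Finset.notMem_empty _ hmem

/-- **(2.47) TYPED (`Close`, torus distance of `T₁^{(k)}`) FOR `C_{Wstep,Λ}`**: for `d ≥ 2`, `L ≥ 1` there are `c₀, δ₀ > 0` such that for every torus
`Setup` with these `(d, L)`, `k + 1 ≤ m + K`, `Λ′₀` in half-torus position, cubes above the `(d, L)`-thresholds with `θ_W < 1`, every `ρ`:
`|C_{Wstep,Λ,loc}(b,b′) − C_{Wstep,Λ}(b,b′)| ≤ δ·e^{2cL}rowBound²·e^{−c|b₋−b′₋|}`, `c = δ₀/(16M_c)`, `δ` the (2.47) constant of file 1.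
[cite: BalabanImbrieJaffe1988, (2.47) p.265, (2.49) p.265; BalabanImbrieJaffe1985, (4.3.3) p.311] -/
theorem close247_stepLam (d L : ℕ) (hd2 : 2 ≤ d) (hL : 1 ≤ L) :
    ∃ c₀ δ₀ : ℝ, 0 < c₀ ∧ 0 < δ₀ ∧ ∀ (P : Params), P.d = d → P.L = L → ∀ (k : ℕ) [DecidableEq (PBond P k)] (hk : k + 1 ≤ P.m + P.K)
      (Λ'₀ : Finset (Fin P.d → ℤ)), HalfBox P.L (Mk P k) Λ'₀ → ∀ (Mc : ℕ), 5 ≤ Mc →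
      kR P.d P.d (gamma2153one P.d P.L) (cA P.d P.L (gamma2153one P.d P.L) c₀ δ₀) δ₀ < Mc →
      thetaConst P.d P.d (gamma2153one P.d P.L) (cA P.d P.L (gamma2153one P.d P.L) c₀ δ₀) δ₀ < Mc →
      thetaW P.d P.d (gamma2153one P.d P.L) (cA P.d P.L (gamma2153one P.d P.L) c₀ δ₀) δ₀ Mc < 1 → ∀ (ρ : ℝ),
      BIJ88Sect2Statements.Close (fun b b' : PBond P k => (supDist b.src b'.src : ℝ))
        (fun b b' => (regaugeMat P k * Matrix.of (fun a a' : PBond P k => sandw P.L (Mk P k) Λ'₀ (cLoc (ldist (N := P.d) Mc) ρ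
            (walkK P.L (Mk P k) Λ'₀ (reDelK (P.L ^ k) (one_le_Lpow P k) (Mk P k)) (gamma2153one P.d P.L) Mc)) (idx P k a) (idx P k a')) *
          (regaugeMat P k)ᵀ) b b')
        (fun b b' : PBond P k =>
          unitPropagator (V411 P k) (curlOp (P := P) (P.eta k ^ P.d) ((P.L : ℝ) ^ k)) (QsE P k) (WstepLam P k Λ'₀) (EuclideanSpace.single b' 1) b)
        (((2 ^ P.d * (gamma2153one P.d P.L)⁻¹ *
                (1 - thetaW P.d P.d (gamma2153one P.d P.L) (cA P.d P.L (gamma2153one P.d P.L) c₀ δ₀) δ₀ Mc)⁻¹ * Real.exp (-(δ₀ / 16 * (ρ - 3)))) *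
              Real.exp (2 * (δ₀ / 16 / Mc) * ((P.L : ℝ) - 1)) * ((P.L : ℝ) ^ P.d + 1) * ((P.L : ℝ) ^ P.d + 1)) *
            Real.exp (2 * (δ₀ / 16 / Mc) * P.L) * rowBound P.d P.L * rowBound P.d P.L)
        (δ₀ / 16 / Mc) := by
  obtain ⟨c₀, δ₀, hc, hδ, H⟩ := close247_gauge_DelK (d := d) (L := L) hd2 hL
  refine ⟨c₀, δ₀, hc, hδ, fun P hPd hPL k _ hk Λ'₀ hbox Mc hM5 hMR hMθ hθW ρ => ?_⟩
  subst hPd hPL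
  have h := H (Mk P k) (L_dvd_Mk hk) (P.L ^ k) (one_le_Lpow P k) Λ'₀ hbox Mc hM5 hMR hMθ hθW ρ
  have hγ := gamma2153one_pos (d := P.d) (L := P.L) (by omega) hL
  have hδ' : 0 ≤ (2 ^ P.d * (gamma2153one P.d P.L)⁻¹ *
        (1 - thetaW P.d P.d (gamma2153one P.d P.L) (cA P.d P.L (gamma2153one P.d P.L) c₀ δ₀) δ₀ Mc)⁻¹ * Real.exp (-(δ₀ / 16 * (ρ - 3)))) *
      Real.exp (2 * (δ₀ / 16 / Mc) * ((P.L : ℝ) - 1)) * ((P.L : ℝ) ^ P.d + 1) * ((P.L : ℝ) ^ P.d + 1) := by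
    have : 0 < 1 - thetaW P.d P.d (gamma2153one P.d P.L) (cA P.d P.L (gamma2153one P.d P.L) c₀ δ₀) δ₀ Mc := by linarith
    positivity
  have hcl := close_tsandw hk hδ' (by positivity) (close_idx (P := P) (k := k) h)
  intro b b'
  have h1 := hcl b b'
  dsimp only at h1 ⊢
  rw [kernel_stepLam_eq_cov hd2 hk]
  exact h1

/-! ## §5 THE SAME FOR THE DIRICHLET PROPAGATOR (4.3.5)-Λ IN BAŁABAN'S CORNER AXIAL GAUGE (`W_Λ`, p09), whose kernel IS `C^{(k)}_Λ∘idx` -/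

/-- **(2.49) FOR THE Λ-DIRICHLET PROPAGATOR OF [I] IN THE CORNER AXIAL GAUGE `W_Λ`** (p09's `kernel_cornerLam_eq_cov`: its kernel is `C^{(k)}_Λ` of [6II]
(2.156) read through `idx`; file 1's `eq249_torus`). [cite: BalabanImbrieJaffe1988, (2.49) p.265; BalabanImbrieJaffe1985, (4.3.5) p.311; Balaban1984PropagatorsII, (2.156) p.250] -/
theorem eq249_cornerLam (d L : ℕ) (hd2 : 2 ≤ d) (hL : 1 ≤ L) :
    ∃ c₀ δ₀ : ℝ, 0 < c₀ ∧ 0 < δ₀ ∧ ∀ (P : Params), P.d = d → P.L = L → ∀ (k : ℕ) [DecidableEq (PBond P k)] (hk : k + 1 ≤ P.m + P.K)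
      (Λ'₀ : Finset (Fin P.d → ℤ)), HalfBox P.L (Mk P k) Λ'₀ → ∀ (Mc : ℕ), 5 ≤ Mc →
      kR P.d P.d (gamma2153one P.d P.L) (cA P.d P.L (gamma2153one P.d P.L) c₀ δ₀) δ₀ < Mc →
      thetaConst P.d P.d (gamma2153one P.d P.L) (cA P.d P.L (gamma2153one P.d P.L) c₀ δ₀) δ₀ < Mc → ∀ (ρ : ℝ) (s : ℕ),
      BIJ88Sect2Statements.Eq245
        (fun b b' : PBond P k =>
          unitPropagator (V411 P k) (curlOp (P := P) (P.eta k ^ P.d) ((P.L : ℝ) ^ k)) (QsE P k) (WcornerLam P k Λ'₀) (EuclideanSpace.single b' 1) b)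
        (fun b b' => sandw P.L (Mk P k) Λ'₀ (cLoc (ldist (N := P.d) Mc) ρ
          (walkK P.L (Mk P k) Λ'₀ (reDelK (P.L ^ k) (one_le_Lpow P k) (Mk P k)) (gamma2153one P.d P.L) Mc)) (idx P k b) (idx P k b'))
        (fun (X : Finset (Cubes Mc s (pbox (Mk P k)))) b b' => sandw P.L (Mk P k) Λ'₀ (cX (ldist (N := P.d) Mc) ρ (cubeOf Mc s) touch
          (walkK P.L (Mk P k) Λ'₀ (reDelK (P.L ^ k) (one_le_Lpow P k) (Mk P k)) (gamma2153one P.d P.L) Mc) X) (idx P k b) (idx P k b')) := by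
  obtain ⟨c₀, δ₀, hc, hδ, H⟩ := eq249_torus d L hd2 hL
  refine ⟨c₀, δ₀, hc, hδ, fun P hPd hPL k _ hk Λ'₀ hbox Mc hM5 hMR hMθ ρ s b b' => ?_⟩
  have h := H P hPd hPL k hk Λ'₀ hbox Mc hM5 hMR hMθ ρ s b b'
  dsimp only at h ⊢
  rw [kernel_cornerLam_eq_cov (hPd ▸ hd2) hk]
  exact h

/-- **(2.41)/(7.2.3)-SHAPE DECAY OF THE Λ-DIRICHLET PROPAGATOR IN THE CORNER AXIAL GAUGE BY THE WALK ROUTE** (file 1's `abs_covLam_le_torus` + p09's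
`kernel_cornerLam_eq_cov`; cf. p09's `ineq723_cornerLam` by the Combes–Thomas route). [cite: BalabanImbrieJaffe1988, (2.41) p.264, (2.49) p.265;
BalabanImbrieJaffe1985, (4.3.5) p.311, (7.2.3) p.325] -/
theorem abs_cornerLam_le_walk (d L : ℕ) (hd2 : 2 ≤ d) (hL : 1 ≤ L) :
    ∃ c₀ δ₀ : ℝ, 0 < c₀ ∧ 0 < δ₀ ∧ ∀ (P : Params), P.d = d → P.L = L → ∀ (k : ℕ) [DecidableEq (PBond P k)] (hk : k + 1 ≤ P.m + P.K)
      (Λ'₀ : Finset (Fin P.d → ℤ)), HalfBox P.L (Mk P k) Λ'₀ → ∀ (Mc : ℕ), 5 ≤ Mc →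
      kR P.d P.d (gamma2153one P.d P.L) (cA P.d P.L (gamma2153one P.d P.L) c₀ δ₀) δ₀ < Mc →
      thetaConst P.d P.d (gamma2153one P.d P.L) (cA P.d P.L (gamma2153one P.d P.L) c₀ δ₀) δ₀ < Mc →
      thetaW P.d P.d (gamma2153one P.d P.L) (cA P.d P.L (gamma2153one P.d P.L) c₀ δ₀) δ₀ Mc < 1 → ∀ b b' : PBond P k,
      |unitPropagator (V411 P k) (curlOp (P := P) (P.eta k ^ P.d) ((P.L : ℝ) ^ k)) (QsE P k) (WcornerLam P k Λ'₀) (EuclideanSpace.single b' 1) b| ≤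
        (2 ^ P.d * (gamma2153one P.d P.L)⁻¹ *
              (1 - thetaW P.d P.d (gamma2153one P.d P.L) (cA P.d P.L (gamma2153one P.d P.L) c₀ δ₀) δ₀ Mc)⁻¹ * Real.exp (δ₀ / 4)) *
          Real.exp (2 * (δ₀ / 8 / Mc) * ((P.L : ℝ) - 1)) * ((P.L : ℝ) ^ P.d + 1) * ((P.L : ℝ) ^ P.d + 1) *
          Real.exp (-(δ₀ / 8 / Mc * (supDist b.src b'.src : ℝ))) := by
  obtain ⟨c₀, δ₀, hc, hδ, H⟩ := abs_covLam_le_torus d L hd2 hL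
  refine ⟨c₀, δ₀, hc, hδ, fun P hPd hPL k _ hk Λ'₀ hbox Mc hM5 hMR hMθ hθW b b' => ?_⟩
  rw [kernel_cornerLam_eq_cov (hPd ▸ hd2) hk]
  exact H P hPd hPL k hk Λ'₀ hbox Mc hM5 hMR hMθ hθW b b'

end

end Literature.MathematicalPhysics.QuantumFieldTheory.BalabanImbrieJaffe1984to88.BIJ88Eq249GaugeCovarianceStepTorus
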